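import Summits.ValiantsHypothesis.ValiantsHypothesis.Theorems.DefinabilityGapSupportRung
import HarnessLib

/-!
# DefinabilityGap — the TOP CORNER of an annihilator is an annihilator (partial seed scaling; unconditional, kernel)
Route `route-ValiantsHypothesis-DefinabilityGap` (decomp-valiant cycle 1, lens 5); a helper of the read-once leaf F4 / W10
(`KIPlantedHittingRO`, stmt-ValiantsHypothesis-23704) in K1 currency. `P_c = kiPer m c` = the `m × m` permanent planted on the
cells `cellEmb m c` of block `c : Fin 3 → Fin (qOf m)`; `φ = bind₁ (kiPer m)`; `G_m` = the planted generator.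
THE MOVE (§§1–2). `Θ_Y = scaleHom Y : y_w ↦ y_w·T (w ∈ Y), y_w ↦ y_w (w ∉ Y)`. FREEZE a block set `F`; if `Y` meets every frozen
block and no LIVE block of `D`, the top `T`-coefficient of `Θ_Y (φ D)` is `∏_c lc(Θ_Y P_c)^{degreeOf_c D} · φ (corner F D)`, where
`corner F D` = the monomials of `D` of full degree `degreeOf_c D` in every frozen `c`, frozen variables stripped (a polynomial in
the live variables): `φ D = 0 ⇒ φ (corner F D) = 0` (`bind₁_corner_eq_zero`, any substitution over any field). For `G_m` such a `Y`
exists once the live blocks are fewer than `m²/2` (`KIPrivate.exists_private`: two blocks share `≤ 2` cells), and the support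
rung `kiPer_hits_support` then forces `corner F D = 0`.
HEADLINE (K1 currency; every `m`; no degree / size / sparsity / width hypothesis; 0 `sorry`): `kiPer_corner_eq_zero`
(`φ D = 0 → 2·#(D.vars \ F) < m·m → corner F D = 0`; cell-explicit form `kiPer_corner_annihilated`); `kiPer_hits_of_shallow_monomial`
and dually `sq_le_two_mul_card_deficient` (every monomial of an annihilator of `G_m` is DEFICIENT, `a_c < degreeOf_c D`, in
`≥ m²/2` of its variables); `kiPer_hits_shallow_eventually` (K1 quantifier shape; contains `kiPer_hits_support_eventually`).
PLACEMENT (honest). The TOP-face dual of the bottom-face roads (`DefinabilityGapPeelingRung`: `z_c ↦ 0`, two punctured cells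
charged per level, depth `≤ (m-2)/2`): top peeling substitutes nothing, charges nothing to the live blocks, has no depth or
multiplicity limit; the frozen blocks are arbitrarily many and DEPENDENT (no independence certificate, so the `m²·q` ceilings of
`DefinabilityGapCertificateCeilings` do not speak to it); `F ⊇ D.vars` is inside `DefinabilityGapTorus.kiPer_cone`, the content
here is `F ⊉ D.vars`. The file closes no item, has 0 S-currency and does not decide RatioLeaf(m) (nor the
cells (α) / (β) of `DefinabilityGapRegularSkeleton`, nor the `b = 2` column). Non-vacuous: annihilators of G_m exist
(kiPer_annihilator_exists, DefinabilityGapK2cPFamilyRung — CT23 L3.2), so ‘every monomial of every annihilator is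
deficient in ≥ m²/2 variables’ quantifies over a non-empty class.
READ-ONCE READING (on paper; nothing of it is typed here). For a read-once chain `D = uᵀ M_1(z_{c_1}) ⋯ M_N(z_{c_N}) v` and a
window of `< m²/2` live links, `corner` = `uᵀ·(frozen links ↦ their top-degree coefficient matrices, live links kept)·v`, so `G_m`
hits every chain with SOME nonzero window product (e.g. the unitriangular chains `uᵀ ∏ (z_{c_i}·I + N_i) v` with one `uᵀ N_j v ≠ 0`,
whose nilpotent constant skeleton stalls on both sides — cell (β)); RESIDUAL: chains whose constant skeleton stalls on both sides
AND whose top skeleton vanishes in every such window. [cite: KabanetsImpagliazzo2003, Lemma 30] [cite: SahaSaptharishiSaxena2009, Lemma 2.1]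
-/
noncomputable section
open MvPolynomial
open Literature.Computability.AlgebraicComplexity Literature.Computability.MetaComplexity

namespace Summit.ValiantsHypothesis.ValiantsHypothesis.Theorems.DefinabilityGapTopCorner
open Summit.ValiantsHypothesis.ValiantsHypothesis.Theorems.DefinabilityGapAffineRung
open Summit.ValiantsHypothesis.ValiantsHypothesis.Theorems.DefinabilityGapSupportRung
section Scale

variable {K : Type*} [Field K] {σ : Type*} [DecidableEq σ]

variable (K) in
/-- The scaling substitution: `y_w ↦ y_w · T` for `w ∈ Y`, `y_w ↦ y_w` otherwise. [this file] -/
def scaleFun (Y : Finset σ) (w : σ) : Polynomial (MvPolynomial σ K) :=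
  if w ∈ Y then Polynomial.C (X w) * Polynomial.X else Polynomial.C (X w)

/-- `Θ_Y`: the partial scaling as a `K`-algebra map `K[y] → K[y][T]`. [this file] -/
def scaleHom (Y : Finset σ) : MvPolynomial σ K →ₐ[K] Polynomial (MvPolynomial σ K) :=
  aeval (scaleFun K Y)

/-- The `Y`-weight `Σ_{w ∈ Y} d w` of an exponent `d`. [this file] -/
def wt (Y : Finset σ) (d : σ →₀ ℕ) : ℕ :=
  d.sum fun w k => if w ∈ Y then k else 0

/-- `Θ_Y` on constants. [this file] -/
theorem scaleHom_C (Y : Finset σ) (r : K) :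
    scaleHom Y (C r : MvPolynomial σ K) = Polynomial.C (C r) := by
  rw [scaleHom, aeval_C, Polynomial.algebraMap_apply, MvPolynomial.algebraMap_eq]

/-- Powers of the scaling substitution. [this file] -/
theorem scaleFun_pow (Y : Finset σ) (i : σ) (k : ℕ) :
    scaleFun K Y i ^ k =
      Polynomial.C ((X i : MvPolynomial σ K) ^ k) * Polynomial.X ^ (if i ∈ Y then k else 0) := by
  unfold scaleFun
  split_ifs with h
  · rw [mul_pow, map_pow]
  · rw [map_pow, pow_zero, mul_one]

/-- The scaling substitution on a monomial's variable product. [this file] -/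
theorem prod_scaleFun_pow (Y : Finset σ) (d : σ →₀ ℕ) :
    (d.prod fun i k => scaleFun K Y i ^ k) =
      Polynomial.C (d.prod fun i k => (X i : MvPolynomial σ K) ^ k) * Polynomial.X ^ wt Y d := by
  simp only [Finsupp.prod, Finsupp.sum, wt, scaleFun_pow]
  rw [map_prod, ← Finset.prod_pow_eq_pow_sum, ← Finset.prod_mul_distrib]

/-- `Θ_Y (monomial d r) = monomial d r · T^{wt_Y d}`. [this file] -/
theorem scaleHom_monomial (Y : Finset σ) (d : σ →₀ ℕ) (r : K) :
    scaleHom Y (monomial d r) = Polynomial.C (monomial d r) * Polynomial.X ^ wt Y d := by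
  rw [scaleHom, aeval_monomial, Polynomial.algebraMap_apply, MvPolynomial.algebraMap_eq, prod_scaleFun_pow,
    ← mul_assoc, ← map_mul, ← monomial_eq]

/-- `Θ_Y f` monomial by monomial. [this file] -/
theorem scaleHom_apply (Y : Finset σ) (f : MvPolynomial σ K) :
    scaleHom Y f = ∑ d ∈ f.support, Polynomial.C (monomial d (coeff d f)) * Polynomial.X ^ wt Y d := by
  conv_lhs => rw [f.as_sum, map_sum]
  exact Finset.sum_congr rfl fun d _ => scaleHom_monomial Y d (coeff d f)

/-- The `T^k`-coefficient of `Θ_Y f` is the weight-`k` part of `f`. [this file] -/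
theorem coeff_scaleHom (Y : Finset σ) (f : MvPolynomial σ K) (k : ℕ) :
    (scaleHom Y f).coeff k = ∑ d ∈ f.support, if k = wt Y d then monomial d (coeff d f) else 0 := by
  rw [scaleHom_apply, Polynomial.finsetSum_coeff]
  exact Finset.sum_congr rfl fun d _ => Polynomial.coeff_C_mul_X_pow _ _ _

/-- `Θ_Y` fixes a polynomial none of whose variables lies in `Y`. [this file] -/
theorem scaleHom_eq_C (Y : Finset σ) {f : MvPolynomial σ K} (h : ∀ w ∈ Y, w ∉ f.vars) :
    scaleHom Y f = Polynomial.C f := by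
  have hwt : ∀ d ∈ f.support, wt Y d = 0 := by
    intro d hd
    simp only [wt, Finsupp.sum]
    refine Finset.sum_eq_zero fun w hw => ?_
    by_cases hwY : w ∈ Y
    · exact absurd ((mem_vars_iff_mem_support w).2 ⟨d, hd, hw⟩) (h w hwY)
    · exact if_neg hwY
  rw [scaleHom_apply]
  conv_rhs => rw [f.as_sum, map_sum]
  exact Finset.sum_congr rfl fun d hd => by rw [hwt d hd, pow_zero, mul_one]

/-- A monomial of `f` of positive `Y`-weight forces `deg_T Θ_Y f ≥ 1`. [this file] -/
theorem natDegree_scaleHom_pos (Y : Finset σ) {f : MvPolynomial σ K} {d : σ →₀ ℕ} {w : σ}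
    (hd : d ∈ f.support) (hw : w ∈ Y) (hdw : d w ≠ 0) : 0 < (scaleHom Y f).natDegree := by
  have hwt : 0 < wt Y d := by
    simp only [wt, Finsupp.sum]
    refine lt_of_lt_of_le (Nat.pos_of_ne_zero hdw) ?_
    calc d w = (if w ∈ Y then d w else 0) := (if_pos hw).symm
      _ ≤ ∑ x ∈ d.support, (if x ∈ Y then d x else 0) :=
        Finset.single_le_sum (f := fun x => if x ∈ Y then d x else 0) (fun _ _ => Nat.zero_le _)
          (Finsupp.mem_support_iff.2 hdw)
  refine lt_of_lt_of_le hwt (Polynomial.le_natDegree_of_ne_zero ?_)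
  intro h
  have h2 := congrArg (coeff d) h
  rw [coeff_scaleHom, coeff_sum, coeff_zero, Finset.sum_eq_single d] at h2
  · rw [if_pos rfl, coeff_monomial, if_pos rfl] at h2
    exact (mem_support_iff.1 hd) h2
  · intro b _ hbd
    split_ifs
    · rw [coeff_monomial, if_neg hbd]
    · exact coeff_zero _
  · exact fun hd' => absurd hd hd'

omit [DecidableEq σ] in
/-- `bind₁` of a monomial as a product over all variables. [folklore] -/
theorem bind₁_monomial_univ {ι : Type*} [Fintype ι] (P : ι → MvPolynomial σ K) (a : ι →₀ ℕ) (r : K) :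
    bind₁ P (monomial a r) = C r * ∏ i, P i ^ a i := by
  rw [bind₁_monomial]
  congr 1
  exact Finset.prod_subset (Finset.subset_univ _) fun i _ hi => by
    rw [Finsupp.notMem_support_iff.1 hi, pow_zero]

end Scale

section Corner

variable {K : Type*} [Field K] {ι : Type*} [DecidableEq ι]

/-- The exponent `a` with its `F`-coordinates removed. [this file] -/
def stripExp (F : Finset ι) (a : ι →₀ ℕ) : ι →₀ ℕ :=
  a.filter fun i => i ∉ F

/-- Pointwise form of `stripExp`. [this file] -/
theorem stripExp_apply (F : Finset ι) (a : ι →₀ ℕ) (i : ι) :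
    stripExp F a i = if i ∈ F then 0 else a i := by
  unfold stripExp
  rw [Finsupp.filter_apply]
  by_cases h : i ∈ F <;> simp [h]

variable [Fintype ι] {σ : Type*} [DecidableEq σ]

/-- The TOP CORNER of `D` along the frozen set `F` (ι finite): the monomials of `D` of full degree `degreeOf c D` in every
`c ∈ F`, the `F`-variables stripped — a polynomial in the variables `D.vars \ F` (`vars_corner_subset`). [this file] -/
def corner (F : Finset ι) (D : MvPolynomial ι K) : MvPolynomial ι K :=
  ∑ a ∈ D.support.filter (fun a => ∀ c ∈ F, a c = degreeOf c D), monomial (stripExp F a) (coeff a D)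

/-- The corner remembers the coefficient of each source monomial (stripping is injective on the face). [this file] -/
theorem coeff_stripExp_corner (F : Finset ι) {D : MvPolynomial ι K} {a : ι →₀ ℕ} (ha : a ∈ D.support)
    (hface : ∀ c ∈ F, a c = degreeOf c D) : coeff (stripExp F a) (corner F D) = coeff a D := by
  rw [corner, coeff_sum, Finset.sum_eq_single a]
  · rw [coeff_monomial, if_pos rfl]
  · intro b hb hba
    rw [coeff_monomial, if_neg]
    intro h
    apply hba
    ext i
    by_cases hi : i ∈ F
    · rw [(Finset.mem_filter.1 hb).2 i hi, hface i hi]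
    · have h' := congrArg (fun e : ι →₀ ℕ => e i) h
      simpa only [stripExp_apply, if_neg hi] using h'
  · exact fun hna => absurd (Finset.mem_filter.2 ⟨ha, hface⟩) hna

/-- A monomial on the `F`-face makes the corner nonzero. [this file] -/
theorem corner_ne_zero (F : Finset ι) {D : MvPolynomial ι K} {a : ι →₀ ℕ} (ha : a ∈ D.support)
    (hface : ∀ c ∈ F, a c = degreeOf c D) : corner F D ≠ 0 := by
  intro h
  have h1 := coeff_stripExp_corner F ha hface
  rw [h, coeff_zero] at h1
  exact (mem_support_iff.1 ha) h1.symm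

/-- The corner reads only the live variables `D.vars \ F`. [this file] -/
theorem vars_corner_subset (F : Finset ι) (D : MvPolynomial ι K) : (corner F D).vars ⊆ D.vars \ F := by
  intro i hi
  obtain ⟨b, hb, hib⟩ := (mem_vars_iff_mem_support i).1 hi
  rw [corner] at hb
  obtain ⟨a, ha, hba⟩ := Finset.mem_biUnion.1 (support_sum hb)
  have hba' : b = stripExp F a := Finset.mem_singleton.1 (support_monomial_subset hba)
  rw [hba', Finsupp.mem_support_iff, stripExp_apply] at hib
  split_ifs at hib with hiF
  · exact absurd rfl hib
  · exact Finset.mem_sdiff.2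
      ⟨(mem_vars_iff_mem_support i).2 ⟨a, (Finset.mem_filter.1 ha).1, Finsupp.mem_support_iff.2 hib⟩, hiF⟩

omit [DecidableEq σ] in
/-- Substituting into the corner: frozen variables contribute nothing. [this file] -/
theorem bind₁_corner (P : ι → MvPolynomial σ K) (F : Finset ι) (D : MvPolynomial ι K) :
    bind₁ P (corner F D) = ∑ a ∈ D.support.filter (fun a => ∀ c ∈ F, a c = degreeOf c D),
      C (coeff a D) * ∏ i ∈ Fᶜ, P i ^ a i := by
  rw [corner, map_sum]
  refine Finset.sum_congr (by congr) fun a _ => ?_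
  have h1 : ∏ i ∈ F, P i ^ stripExp F a i = 1 :=
    Finset.prod_eq_one fun i hi => by rw [stripExp_apply, if_pos hi, pow_zero]
  have h2 : ∏ i ∈ Fᶜ, P i ^ stripExp F a i = ∏ i ∈ Fᶜ, P i ^ a i :=
    Finset.prod_congr rfl fun i hi => by rw [stripExp_apply, if_neg (Finset.mem_compl.1 hi)]
  rw [bind₁_monomial_univ, ← Finset.prod_mul_prod_compl F, h1, one_mul, h2]

/-- **The top corner of an annihilator is an annihilator** (any field, any substitution): if `Θ_Y` raises the `T`-degree of
every frozen `P_c` and fixes every live `P_j` (`j ∈ D.vars \ F`), then `bind₁ P D = 0 → bind₁ P (corner F D) = 0`. [this file] -/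
theorem bind₁_corner_eq_zero (P : ι → MvPolynomial σ K) (Y : Finset σ) (F : Finset ι) (D : MvPolynomial ι K)
    (hF : ∀ c ∈ F, 0 < (scaleHom Y (P c)).natDegree)
    (hJ : ∀ j ∈ D.vars, j ∉ F → scaleHom Y (P j) = Polynomial.C (P j))
    (hD : bind₁ P D = 0) : bind₁ P (corner F D) = 0 := by
  have hQ : ∀ c ∈ F, scaleHom Y (P c) ≠ 0 := fun c hc h0 => by
    have h1 := hF c hc
    rw [h0, Polynomial.natDegree_zero] at h1
    exact lt_irrefl 0 h1
  obtain ⟨top, htop⟩ :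
      ∃ t : Polynomial (MvPolynomial σ K), t = ∏ c ∈ F, scaleHom Y (P c) ^ degreeOf c D := ⟨_, rfl⟩
  have htop_ne : top ≠ 0 := by
    rw [htop]
    exact Finset.prod_ne_zero_iff.2 fun c hc => pow_ne_zero _ (hQ c hc)
  have hLC : top.leadingCoeff ≠ 0 := Polynomial.leadingCoeff_ne_zero.2 htop_ne
  have hterm : ∀ a ∈ D.support, scaleHom Y (bind₁ P (monomial a (coeff a D))) =
      Polynomial.C (C (coeff a D) * ∏ i ∈ Fᶜ, P i ^ a i) * ∏ c ∈ F, scaleHom Y (P c) ^ a c := by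
    intro a ha
    have hlive : ∀ i ∈ Fᶜ, scaleHom Y (P i) ^ a i = Polynomial.C (P i ^ a i) := by
      intro i hi
      rw [Finset.mem_compl] at hi
      by_cases hai : a i = 0
      · rw [hai, pow_zero, pow_zero, map_one]
      · rw [hJ i ((mem_vars_iff_mem_support i).2 ⟨a, ha, Finsupp.mem_support_iff.2 hai⟩) hi, map_pow]
    rw [bind₁_monomial_univ, map_mul, scaleHom_C, map_prod]
    simp only [map_pow]
    rw [← Finset.prod_mul_prod_compl F, Finset.prod_congr rfl hlive, ← map_prod, map_mul]
    ring
  have h1 : scaleHom Y (bind₁ P D) = ∑ a ∈ D.support,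
      Polynomial.C (C (coeff a D) * ∏ i ∈ Fᶜ, P i ^ a i) * ∏ c ∈ F, scaleHom Y (P c) ^ a c := by
    conv_lhs => rw [D.as_sum, map_sum, map_sum]
    exact Finset.sum_congr rfl hterm
  rw [hD, map_zero] at h1
  have h2 : ∑ a ∈ D.support, (C (coeff a D) * ∏ i ∈ Fᶜ, P i ^ a i) *
      (∏ c ∈ F, scaleHom Y (P c) ^ a c).coeff top.natDegree = 0 := by
    have h := congrArg (fun p : Polynomial (MvPolynomial σ K) => p.coeff top.natDegree) h1
    simpa only [Polynomial.finsetSum_coeff, Polynomial.coeff_C_mul, Polynomial.coeff_zero] using h.symm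
  have hcase : ∀ a ∈ D.support, (∏ c ∈ F, scaleHom Y (P c) ^ a c).coeff top.natDegree =
      if (∀ c ∈ F, a c = degreeOf c D) then top.leadingCoeff else 0 := by
    intro a ha
    split_ifs with hface
    · have hprod : ∏ c ∈ F, scaleHom Y (P c) ^ a c = top := by
        rw [htop]
        exact Finset.prod_congr rfl fun c hc => by rw [hface c hc]
      rw [hprod, Polynomial.coeff_natDegree]
    · apply Polynomial.coeff_eq_zero_of_natDegree_lt
      rw [htop, Polynomial.natDegree_prod _ _ fun c hc => pow_ne_zero (a c) (hQ c hc),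
        Polynomial.natDegree_prod _ _ fun c hc => pow_ne_zero (degreeOf c D) (hQ c hc)]
      simp only [Polynomial.natDegree_pow]
      push Not at hface
      obtain ⟨c₀, hc₀, hne⟩ := hface
      exact Finset.sum_lt_sum (fun c _ => Nat.mul_le_mul_right _ (monomial_le_degreeOf c ha))
        ⟨c₀, hc₀,
          Nat.mul_lt_mul_of_pos_right (lt_of_le_of_ne (monomial_le_degreeOf c₀ ha) hne) (hF c₀ hc₀)⟩
  have h3 : ∑ a ∈ D.support, (C (coeff a D) * ∏ i ∈ Fᶜ, P i ^ a i) *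
      (∏ c ∈ F, scaleHom Y (P c) ^ a c).coeff top.natDegree =
      ∑ a ∈ D.support, if (∀ c ∈ F, a c = degreeOf c D)
        then (C (coeff a D) * ∏ i ∈ Fᶜ, P i ^ a i) * top.leadingCoeff else 0 := by
    refine Finset.sum_congr rfl fun a ha => ?_
    rw [hcase a ha, mul_ite, mul_zero]
  rw [h3, ← Finset.sum_filter, ← Finset.sum_mul] at h2
  have h4 := (mul_eq_zero.1 h2).resolve_right hLC
  rw [bind₁_corner]
  exact h4

end Corner

section KI

/-- `Θ_Y` fixes `P_j` when `Y` holds no cell of block `j`. [this file] -/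
theorem scaleHom_kiPer_eq_C {m : ℕ} {Y : Finset (Fin (qOf m) × Fin (qOf m))} {j : Fin 3 → Fin (qOf m)}
    (hY : ∀ y ∈ Y, y ∉ Finset.univ.map (cellEmb m j)) :
    scaleHom Y (kiPer m j) = Polynomial.C (kiPer m j) := by
  refine scaleHom_eq_C Y fun y hy hv => hY y hy ?_
  rw [kiPer_eq_rename_cellEmb] at hv
  obtain ⟨v, -, rfl⟩ := Finset.mem_image.1 (vars_rename _ _ hv)
  exact Finset.mem_map.2 ⟨v, Finset.mem_univ _, rfl⟩

/-- `Θ_Y` raises the `T`-degree of `P_c` when `Y` holds a cell of block `c` (each cell has degree `1` in `per`). [this file] -/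
theorem natDegree_scaleHom_kiPer_pos {m : ℕ} {Y : Finset (Fin (qOf m) × Fin (qOf m))}
    {c : Fin 3 → Fin (qOf m)} (p : Fin m × Fin m) (hp : cellEmb m c p ∈ Y) :
    0 < (scaleHom Y (kiPer m c)).natDegree := by
  have hdeg : degreeOf (cellEmb m c p) (kiPer m c) = 1 := by
    rw [kiPer_eq_rename_cellEmb, degreeOf_rename_of_injective (cellEmb m c).injective, degreeOf_perPoly]
  have h1 : ¬ degreeOf (cellEmb m c p) (kiPer m c) ≤ 0 := by
    rw [hdeg]
    omega
  rw [degreeOf_le_iff] at h1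
  push Not at h1
  obtain ⟨d, hd, hdp⟩ := h1
  exact natDegree_scaleHom_pos Y hd hp (Nat.pos_iff_ne_zero.1 hdp)

/-- A frozen block off a co-small family `J` has a cell private from every block of `J` (design: two blocks share
`≤ 2` cells). [cite: KabanetsImpagliazzo2003, Lemma 30 (design argument)] -/
theorem exists_cell_notMem (m : ℕ) {c : Fin 3 → Fin (qOf m)} {J : Finset (Fin 3 → Fin (qOf m))}
    (hcJ : c ∉ J) (hJ : 2 * J.card < m * m) :
    ∃ p : Fin m × Fin m, ∀ j ∈ J, cellEmb m c p ∉ Finset.univ.map (cellEmb m j) := by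
  have hE : IsNWDesign 2 (fun c : Fin 3 → Fin (qOf m) => cellEmb m c) := subDesign_isNWDesign m
  have hT : 2 * ((insert c J).card - 1) < m * m := by
    rw [Finset.card_insert_of_notMem hcJ, Nat.add_sub_cancel]
    exact hJ
  obtain ⟨p, hp⟩ := KIPrivate.exists_private hE (insert c J) hT (Finset.mem_insert_self c J)
  exact ⟨p, fun j hj => hp j (Finset.mem_insert_of_mem hj) fun h => hcJ (h ▸ hj)⟩

/-- **The top corner of an annihilator of `G_m` is an annihilator** (cell-explicit form): if `Y` holds a cell of
every frozen block and no cell of a live block of `D`, then `φ D = 0 → φ (corner F D) = 0`. [this file] -/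
theorem kiPer_corner_annihilated (m : ℕ) (Y : Finset (Fin (qOf m) × Fin (qOf m)))
    (F : Finset (Fin 3 → Fin (qOf m))) {D : MvPolynomial (Fin 3 → Fin (qOf m)) ℂ}
    (hYF : ∀ c ∈ F, ∃ p : Fin m × Fin m, cellEmb m c p ∈ Y)
    (hYJ : ∀ j ∈ D.vars, j ∉ F → ∀ y ∈ Y, y ∉ Finset.univ.map (cellEmb m j))
    (hD : bind₁ (kiPer m) D = 0) : bind₁ (kiPer m) (corner F D) = 0 := by
  refine bind₁_corner_eq_zero (kiPer m) Y F D (fun c hc => ?_)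
    (fun j hj hjF => scaleHom_kiPer_eq_C (hYJ j hj hjF)) hD
  obtain ⟨p, hp⟩ := hYF c hc
  exact natDegree_scaleHom_kiPer_pos p hp

/-- **The top corner of an annihilator of `G_m` is EMPTY** along every frozen set whose live complement in `D.vars`
has fewer than `m²/2` blocks (all `m`; no degree, size or width hypothesis). [this file] -/
theorem kiPer_corner_eq_zero (m : ℕ) (F : Finset (Fin 3 → Fin (qOf m)))
    {D : MvPolynomial (Fin 3 → Fin (qOf m)) ℂ} (hJ : 2 * (D.vars \ F).card < m * m)
    (hD : bind₁ (kiPer m) D = 0) : corner F D = 0 := by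
  obtain ⟨Y, hYF, hYJ⟩ : ∃ Y : Finset (Fin (qOf m) × Fin (qOf m)),
      (∀ c ∈ F, ∃ p : Fin m × Fin m, cellEmb m c p ∈ Y) ∧
      (∀ j ∈ D.vars, j ∉ F → ∀ y ∈ Y, y ∉ Finset.univ.map (cellEmb m j)) := by
    refine ⟨Finset.univ.filter fun y => ∀ j ∈ D.vars \ F, y ∉ Finset.univ.map (cellEmb m j),
      fun c hc => ?_, fun j hj hjF y hy => (Finset.mem_filter.1 hy).2 j (Finset.mem_sdiff.2 ⟨hj, hjF⟩)⟩
    obtain ⟨p, hp⟩ : ∃ p : Fin m × Fin m, ∀ j ∈ D.vars \ F,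
        cellEmb m c p ∉ Finset.univ.map (cellEmb m j) :=
      exists_cell_notMem m (fun h => (Finset.mem_sdiff.1 h).2 hc) hJ
    exact ⟨p, Finset.mem_filter.2 ⟨Finset.mem_univ _, hp⟩⟩
  have hann : bind₁ (kiPer m) (corner F D) = 0 := kiPer_corner_annihilated m Y F hYF hYJ hD
  rcases eq_or_ne (corner F D) 0 with h0 | hne
  · exact h0
  · exact absurd hann (kiPer_hits_support m hne (lt_of_le_of_lt
      (Nat.mul_le_mul_left 2 ((Nat.sub_le _ 1).trans (Finset.card_le_card (vars_corner_subset F D)))) hJ))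

/-- Hitting form: a nonzero top corner along a co-small frozen set certifies `φ D ≠ 0`. [this file] -/
theorem kiPer_hits_of_corner_ne_zero (m : ℕ) (F : Finset (Fin 3 → Fin (qOf m)))
    {D : MvPolynomial (Fin 3 → Fin (qOf m)) ℂ} (hJ : 2 * (D.vars \ F).card < m * m) (hc : corner F D ≠ 0) :
    bind₁ (kiPer m) D ≠ 0 := by
  exact fun hD => hc (kiPer_corner_eq_zero m F hJ hD)

/-- **Shallow-monomial hitting** (K1 currency, all `m`): if some monomial `a` of `D` attains the full degree
`degreeOf c D` in all but `k` of the variables of `D` and `2k < m²`, then `G_m` hits `D`. [this file] -/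
theorem kiPer_hits_of_shallow_monomial (m : ℕ) {D : MvPolynomial (Fin 3 → Fin (qOf m)) ℂ}
    {a : (Fin 3 → Fin (qOf m)) →₀ ℕ} (ha : a ∈ D.support)
    (hdef : 2 * (D.vars.filter fun c => a c < degreeOf c D).card < m * m) : bind₁ (kiPer m) D ≠ 0 := by
  refine kiPer_hits_of_corner_ne_zero m (D.vars.filter fun c => a c = degreeOf c D) ?_
    (corner_ne_zero _ ha fun c hc => (Finset.mem_filter.1 hc).2)
  have hset : D.vars \ (D.vars.filter fun c => a c = degreeOf c D) =
      D.vars.filter fun c => a c < degreeOf c D := by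
    ext c
    rw [Finset.mem_sdiff, Finset.mem_filter, Finset.mem_filter]
    constructor
    · rintro ⟨hc, h⟩
      exact ⟨hc, lt_of_le_of_ne (monomial_le_degreeOf c ha) fun heq => h ⟨hc, heq⟩⟩
    · rintro ⟨hc, hlt⟩
      exact ⟨hc, fun h => (ne_of_lt hlt) h.2⟩
  rw [hset]
  exact hdef

/-- **Deficiency of annihilators**: each monomial of an annihilator of `G_m` misses `degreeOf c D` in `≥ m²/2` variables. [this file] -/
theorem sq_le_two_mul_card_deficient (m : ℕ) {D : MvPolynomial (Fin 3 → Fin (qOf m)) ℂ}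
    (hD : bind₁ (kiPer m) D = 0) {a : (Fin 3 → Fin (qOf m)) →₀ ℕ} (ha : a ∈ D.support) :
    m * m ≤ 2 * (D.vars.filter fun c => a c < degreeOf c D).card := by
  exact not_lt.1 fun h => kiPer_hits_of_shallow_monomial m ha h hD

/-- **K1 quantifier shape**: for every deficiency bound `t`, every `m > 2t` (so some `m ≥ m₀`) hits every `D` having a monomial
of full degree in all but `≤ t` of its variables; contains `kiPer_hits_support_eventually` (`#D.vars ≤ t`). [this file] -/
theorem kiPer_hits_shallow_eventually (t m₀ : ℕ) : ∃ m, m₀ ≤ m ∧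
    ∀ (D : MvPolynomial (Fin 3 → Fin (qOf m)) ℂ) (a : (Fin 3 → Fin (qOf m)) →₀ ℕ), a ∈ D.support →
      (D.vars.filter fun c => a c < degreeOf c D).card ≤ t → bind₁ (kiPer m) D ≠ 0 := by
  refine ⟨m₀ + 2 * t + 1, by omega, fun D a ha ht => kiPer_hits_of_shallow_monomial _ ha ?_⟩
  have h1 : 2 * (D.vars.filter fun c => a c < degreeOf c D).card < 2 * t + 1 := by omega
  have h2 : 2 * t + 1 ≤ (m₀ + 2 * t + 1) * (m₀ + 2 * t + 1) :=
    le_trans (by omega) (Nat.le_mul_self _)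
  exact lt_of_lt_of_le h1 h2

end KI

end Summit.ValiantsHypothesis.ValiantsHypothesis.Theorems.DefinabilityGapTopCorner

end
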